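import Mathlib
import HarnessLib
import Literature.Computability.AlgebraicComplexity.DivisionSLP
import Summits.MatrixMultiplication.Statement
import Summits.MatrixMultiplication.MatrixMultiplication.Theses.LongExchangeCondensation
import Summits.MatrixMultiplication.MatrixMultiplication.Theorems.CondensationDistanceCondensationSound
import Summits.MatrixMultiplication.MatrixMultiplication.Theorems.LongExchangeCondensationLongExchangeSoundStubLongExchange
import Summits.MatrixMultiplication.MatrixMultiplication.Theorems.LongExchangeCondensationLongExchangeSoundStubLongSimulation

/-!
# Crux `LongExchangeSound` (stmt-MatrixMultiplication-20136) — PROVED: long Plücker-exchange derivations are sound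

Route `MatrixMultiplication/LongExchangeCondensation` (forward route; deciding theorem
`closes : LongExchangeSound → ShortLongCondensation → MatrixMultiplication`).  The crux is the RUNG over the floor
`Theorems.CondensationSound.CondensationSound_of` (route `CondensationDistance`, stmt-MatrixMultiplication-15939) with the
ARITY hypothesis of the exchange move generalised: a step of a valid weighted derivation `(f, g)` on the `n`-subsets of
`Fin (n + m')` is either octahedral (`g i = 1`, three-term Grassmann–Plücker exchange, verbatim as in the floor) or a long
single-pivot exchange of arity `g i ≥ 2` (pivot `p ∈ f i`, `Q ⊆ f i − p` with `|Q| = g i`, `U` disjoint from `f i` with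
`|U| = g i + 1`; divisor `(f i − p − Q) ∪ U` and the `2 g i + 2` mates free or listed earlier); if the target `[n, 2n)`
is listed, `det X_n` is derivable WITH DIVISION from the entries of the generic `n × m'` matrix in `Σ_i (2·g i + 3)`
Ω-steps over `ℂ` (BCS 1997, Def. (4.7); `Literature/…/DivisionSLP.lean`).

## Proof (the registered birth skeleton: `stub_longExchange`, `stub_longSimulation`, composed here)

Same coordinate system as the floor: `P J := φ (det ([1 | Z] ∘ sorted J))` for `|J| = n` (junk `0` otherwise, never
used), `[1 | Z] = (fromCols 1 Z) ∘ finSumFinEquiv.symm`, `φ : ℂ[Z] → ℂ(Z)`.  Its four local properties are the floor's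
glue lemmas `ball_of_stubs` (ball values are inputs/constants up to a sign), `nonvanishing_of_stubs`,
`exchange_of_stubs` (three-term relation) and `target_of_stubs` (`P [n,2n) = +det X`), imported from
`Theorems/CondensationDistanceCondensationSound.lean`; the new local property is the `(s+2)`-term single-pivot relation
`P J · P K = Σ_{u ∈ U} ε_u · P (J−p+u) · P (((J∖Q)∪U)−u)` (`stub_longExchange`, file `…StubLongExchange.lean`, from the
quadratic Plücker relation `det_mul_det_eq_sum_det_updateCol`), and the bookkeeping is the weighted simulation
`stub_longSimulation` (file `…StubLongSimulation.lean`: an arity-`s` step is `s+1` products, `s` linear combinations with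
free scalars absorbing all signs, one inverse, one product = `2s+3` steps with EXACT output).  `Derivable` is monotone in
the target, and the target value is `det X` on the nose.

Also recorded (forward-generator bookkeeping, TRIBUNAL-FIT F4): `LongExchangeSound_of_MatrixMultiplication :
MatrixMultiplication → LongExchangeSound` — trivial BECAUSE the rung is proved outright; the rung is a model-soundness
lemma and not a consequence of `ω(ℂ) = 2` in any contentful sense (see the on-path lander's evidence note on the item).
Sources: BurgisserClausenShokrollahi1997 Def. (4.4)/(4.7); FallatJohnson2011 §1.2, FominGrigorievKoshevoy2014 (Plücker
relations as exchange steps); Dodgson1867 / Bareiss1968 (condensation).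
-/

set_option linter.dupNamespace false

namespace Summit.MatrixMultiplication.MatrixMultiplication.Theorems.LongExchangeSound

open scoped BigOperators Matrix
open Literature.Computability.AlgebraicComplexity (Derivable)
open Summit.MatrixMultiplication.MatrixMultiplication.Theses.LongExchangeCondensation (LongExchangeSound)
open Summit.MatrixMultiplication.MatrixMultiplication.Theorems.CondensationSound
  (ball_of_stubs nonvanishing_of_stubs exchange_of_stubs target_of_stubs)

/-- **THE RUNG, PROVED.** The crux
`Summit.MatrixMultiplication.MatrixMultiplication.Theses.LongExchangeCondensation.LongExchangeSound`
(stmt-MatrixMultiplication-20136): run the weighted simulation `stub_longSimulation` on the raw-minor coordinate system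
`P J := φ (det ([1 | Z] ∘ sorted J))`, whose four prerequisites are the floor's `ball_of_stubs`, `nonvanishing_of_stubs`,
`exchange_of_stubs` and the long relation `stub_longExchange`; the derived set contains `P (f i₀) = P [n,2n) = det X`
(`target_of_stubs`), and `Derivable` is monotone in the target. [cite: BurgisserClausenShokrollahi1997, Def. (4.7)] -/
theorem LongExchangeSound_of : LongExchangeSound := by
  intro n m' h l f g hvalid htgt
  classical
  let P : Finset (Fin (n + m')) → FractionRing (MvPolynomial (Fin n × Fin m') ℂ) := fun J =>
    if hJ : J.card = n then
      algebraMap (MvPolynomial (Fin n × Fin m') ℂ) (FractionRing (MvPolynomial (Fin n × Fin m') ℂ))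
        (((Matrix.fromCols (1 : Matrix (Fin n) (Fin n) (MvPolynomial (Fin n × Fin m') ℂ))
          (Matrix.of fun i j => MvPolynomial.X (i, j))).submatrix id ⇑finSumFinEquiv.symm).submatrix
            id ⇑(J.orderEmbOfFin hJ)).det
    else 0
  have hP : ∀ (J : Finset (Fin (n + m'))) (hJ : J.card = n), P J =
      algebraMap (MvPolynomial (Fin n × Fin m') ℂ) (FractionRing (MvPolynomial (Fin n × Fin m') ℂ))
        (((Matrix.fromCols (1 : Matrix (Fin n) (Fin n) (MvPolynomial (Fin n × Fin m') ℂ))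
          (Matrix.of fun i j => MvPolynomial.X (i, j))).submatrix id ⇑finSumFinEquiv.symm).submatrix
            id ⇑(J.orderEmbOfFin hJ)).det := fun J hJ => dif_pos hJ
  have hD := stub_longSimulation (FractionRing (MvPolynomial (Fin n × Fin m') ℂ)) _ n m' P
    (ball_of_stubs n m' P hP) (nonvanishing_of_stubs n m' P hP) (exchange_of_stubs n m' P hP)
    (stub_longExchange n m' P hP) l f g hvalid
  obtain ⟨i₀, hi₀⟩ := htgt
  refine hD.mono le_rfl subset_rfl ?_
  intro x hx
  rw [Set.mem_singleton_iff] at hx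
  subst hx
  refine ⟨i₀, ?_⟩
  show P (f i₀) = _
  rw [hi₀]
  exact target_of_stubs n m' P hP h

/-- **On-path record (forward-generator bookkeeping, TRIBUNAL-FIT F4).**  `MatrixMultiplication → LongExchangeSound`,
trivially, because the rung `LongExchangeSound` is a theorem (`LongExchangeSound_of`).  Caveat, stated for the
record: the rung is a model-soundness lemma (exact Ω-cost of individual Plücker-exchange derivations) and is NOT a
consequence of `ω(ℂ) = 2` in any contentful sense — no specialisation or monotonicity connects them; this implication
holds only through the outright proof. [folklore] -/
theorem LongExchangeSound_of_MatrixMultiplication : _root_.MatrixMultiplication → LongExchangeSound :=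
  fun _ => LongExchangeSound_of

end Summit.MatrixMultiplication.MatrixMultiplication.Theorems.LongExchangeSound
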